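import Summits.ResolutionOfSingularities.ResolutionOfSingularities.Theorems.FrobeniusLadderFInjectiveMacaulayficationKLocCellRange
import HarnessLib

/-!
# (U11) THE TRUNCATED FEDDER CELL `KLocCellMod`: the split identity only modulo `(Y_i^p : i ∈ S)`
# (crux `FInjectiveMacaulayfication`, road B «K-loc certificate → `CICertificates.ciCertificates`», §2′/§3′ of
# res-L1-w45a-plan-1's RULING R12.31 = `KLocCell` (p516325) / `KLocCellRange` (p516930) with a weakened cells binder)

Support file for crux stmt-ResolutionOfSingularities-15315 (`FrobeniusLadder.FInjectiveMacaulayfication`), chain w45a, seat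
res-L1-w45a-stub-3 (object U11, R12.31 / R12.37 (a)). [OURS · L1 W4.5a] — produced inside this programme; reviewed only by AI
agents (AI review is weaker than expert human review). No statement of the manuscript is used.

THE POINT. The cell `KLocCell(g; S)` of `KLocCell.fedderAt_of_kLocCell` asks for an EXACT split
`g^(p-1) = Σ_{e ∈ L} Y^{e.1} · expand p e.2`; for the `T⁽⁴⁾/7` campaign `g⁶` has ≈ 10³ terms and most of them are useless:
at a point `a` of the stratum (`a_i = 0` for `i ∈ S`) Fedder's test is membership in `𝔪_a^{[p]} = ((Y_i − a_i)^p : i)`, and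
`Y_i^p = (Y_i − a_i)^p ∈ 𝔪_a^{[p]}` for `i ∈ S` — so every term of `g^(p-1)` divisible by some `Y_i^p`, `i ∈ S`, may be DROPPED.
This file proves the cell sound with the split required only MODULO the ideal `(Y_i^p : i ∈ S)`:

* §1 `notMem_of_split_of_aeval_expand_ne_zero` — res-L1-w45a-stub-3's certificate-free core
  (`FaceFPureOfMonomialPCoeff.fedder_of_aeval_expand_ne_zero`) for an ARBITRARY polynomial `H` in split form
  `H = Σ_α ψ_p(c_α) · Y^α` with one `ψ_p(c_α)(b) ≠ 0`: `H ⊗ K ∉ ((Y_i − b_i)^p : i)` (same proof; the core never used that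
  `H` is a `(p-1)`-th power);
* §2 `fedderAt_of_kLocCell_mod` — **§2′: FEDDER'S TEST AT EVERY POINT OF ONE STRATUM FROM ITS TRUNCATED CELL**: data `L`, `rr`,
  `t`, `t₀` as in `KLocCell.fedderAt_of_kLocCell`, but the split hypothesis is
  `g^(p-1) − Σ_{e ∈ L} Y^{e.1} · expand p e.2 ∈ Ideal.span ((fun i => Y_i^p) '' S)`;
* §3 `pointFedder_of_kLocCells_mod`, `honQuot_of_kLocCells_mod` (`Ideal.span {g}` form) and
  `honQuot_of_kLocCells_mod_range` (`gs : Fin 1 → k[Y]`, `Ideal.span (Set.range gs)` form = the `hon' c` binder of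
  `CICertificates.ciCertificates` at `r = 1`) — **§3′**: `KLocCell.quotientChartClause_of_pointFedder` /
  `KLocCellRange.quotientChartClause_of_pointFedder_range` fed by §2 over the strata cover, with the weakened cells binder
  `hcellsMod`.

The computable side (`checkKMod`/`klocCellsMod_of_check`: truncate during `powK`, prove the ideal membership of the
difference) is the kit owner's. No definitions, no named facts; glue. [cite: Fedder1983, Prop. 1.7 and Thm. 1.12 (criterion);
folklore otherwise]
-/


noncomputable section

namespace Summit.ResolutionOfSingularities.ResolutionOfSingularities.Theorems.FInjectiveMacaulayfication.KLocCellMod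

open MvPolynomial
open Summit.ResolutionOfSingularities.ResolutionOfSingularities.Theorems.FInjectiveMacaulayfication
open Literature.RingTheory.TightClosure FaceFPureOfCertificate

/-! ## §1 The certificate-free core for an arbitrary polynomial in split form -/

/-- **One non-vanishing `p`-coefficient keeps a split polynomial out of `𝔪_b^{[p]}`**: if
`H = Σ_α ψ_p(c_α) · Y^α` (reduced `α`) and `ψ_p(c_α)(b) ≠ 0` for some `α`, then `H ⊗ K ∉ ((Y_i − b_i)^p : i)`.
(`FaceFPureOfMonomialPCoeff.fedder_of_aeval_expand_ne_zero` is the case `H = F^(p-1)`; the proof is the same: shift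
`Y_i ↦ Y_i + b_i`, reduce modulo `(Y_i^p)`, compare `Y_i`-degrees `< p`, shift back, read off the coefficient.) [folklore] -/
theorem notMem_of_split_of_aeval_expand_ne_zero (p : ℕ) [Fact p.Prime] {k : Type} [Field k] [CharP k p] {n : ℕ}
    (H : MvPolynomial (Fin n) k) (c : (Fin n → Fin p) → MvPolynomial (Fin n) k)
    (hH : H = ∑ α : Fin n → Fin p, MvPolynomial.expand p (c α) *
      MvPolynomial.monomial (Finsupp.equivFunOnFinite.symm fun j => ((α j : ℕ))) 1)
    {K : Type} [Field K] [Algebra k K] (b : Fin n → K)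
    (hex : ∃ α : Fin n → Fin p, MvPolynomial.aeval b (MvPolynomial.expand p (c α)) ≠ 0) :
    MvPolynomial.map (algebraMap k K) H ∉
      Ideal.span (Set.range fun i : Fin n => (MvPolynomial.X i - MvPolynomial.C (b i)) ^ p) := by
  -- adapted from `FaceFPureOfMonomialPCoeff.fedder_of_aeval_expand_ne_zero` (same seat), `F ^ (p - 1)` ↦ `H`
  intro hmem
  classical
  have hp : 0 < p := (Fact.out : p.Prime).pos
  haveI : CharP K p := charP_of_injective_algebraMap (algebraMap k K).injective p
  haveI : CharP (MvPolynomial (Fin n) K) p := charP_of_injective_algebraMap (MvPolynomial.C_injective (Fin n) K) p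
  obtain ⟨α₀, hα₀⟩ := hex
  -- the split form of `H ⊗ K`
  have hG : MvPolynomial.map (algebraMap k K) H = ∑ α : Fin n → Fin p,
      MvPolynomial.expand p (MvPolynomial.map (algebraMap k K) (c α)) *
        MvPolynomial.monomial (Finsupp.equivFunOnFinite.symm fun j => ((α j : ℕ))) (1 : K) := by
    rw [hH, map_sum]
    refine Finset.sum_congr rfl fun α _ => ?_
    rw [map_mul, MvPolynomial.map_expand, MvPolynomial.map_monomial, map_one]
  -- shift `τ : yᵢ ↦ yᵢ + bᵢ`: `τ (H ⊗ K) ∈ (yᵢ^p)`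
  have hτJ : MvPolynomial.aeval (fun i : Fin n => (MvPolynomial.X i : MvPolynomial (Fin n) K) + MvPolynomial.C (b i))
      (MvPolynomial.map (algebraMap k K) H) ∈
      Ideal.span (Set.range fun i : Fin n => (MvPolynomial.X i : MvPolynomial (Fin n) K) ^ p) := by
    have h1 := Ideal.mem_map_of_mem (MvPolynomial.aeval (R := K)
      (fun i : Fin n => (MvPolynomial.X i : MvPolynomial (Fin n) K) + MvPolynomial.C (b i))).toRingHom hmem
    rw [Ideal.map_span, ← Set.range_comp] at h1
    have h2 : ((MvPolynomial.aeval (R := K)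
        (fun i : Fin n => (MvPolynomial.X i : MvPolynomial (Fin n) K) + MvPolynomial.C (b i))).toRingHom ∘
        fun i : Fin n => ((MvPolynomial.X i : MvPolynomial (Fin n) K) - MvPolynomial.C (b i)) ^ p) =
        fun i : Fin n => (MvPolynomial.X i : MvPolynomial (Fin n) K) ^ p := by
      funext i
      simp only [Function.comp_apply, AlgHom.toRingHom_eq_coe, RingHom.coe_coe, map_pow, map_sub, MvPolynomial.aeval_X,
        MvPolynomial.aeval_C, MvPolynomial.algebraMap_eq, add_sub_cancel_right]
    rw [h2] at h1
    exact h1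
  -- the scalars `s_α = c_α(b^p)`
  set s : (Fin n → Fin p) → K := fun α => MvPolynomial.constantCoeff (MvPolynomial.aeval
    (fun i : Fin n => (MvPolynomial.X i : MvPolynomial (Fin n) K) + MvPolynomial.C (b i ^ p))
      (MvPolynomial.map (algebraMap k K) (c α))) with hs_def
  -- `P := Σ_α C(s_α) ∏ (yⱼ + bⱼ)^(αⱼ)` lies in `(yᵢ^p)`
  have hP : ∑ α : Fin n → Fin p, MvPolynomial.C (s α) *
      ∏ j : Fin n, ((MvPolynomial.X j : MvPolynomial (Fin n) K) + MvPolynomial.C (b j)) ^ ((α j : ℕ)) ∈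
      Ideal.span (Set.range fun i : Fin n => (MvPolynomial.X i : MvPolynomial (Fin n) K) ^ p) := by
    rw [hG, map_sum] at hτJ
    have hdiff : ∑ α : Fin n → Fin p, (MvPolynomial.aeval
        (fun i : Fin n => (MvPolynomial.X i : MvPolynomial (Fin n) K) + MvPolynomial.C (b i))
        (MvPolynomial.expand p (MvPolynomial.map (algebraMap k K) (c α)) *
          MvPolynomial.monomial (Finsupp.equivFunOnFinite.symm fun j => ((α j : ℕ))) (1 : K)) -
        MvPolynomial.C (s α) * ∏ j : Fin n, ((MvPolynomial.X j : MvPolynomial (Fin n) K) + MvPolynomial.C (b j)) ^ ((α j : ℕ))) ∈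
        Ideal.span (Set.range fun i : Fin n => (MvPolynomial.X i : MvPolynomial (Fin n) K) ^ p) := by
      refine Ideal.sum_mem _ fun α _ => ?_
      have hmon : MvPolynomial.aeval (fun i : Fin n => (MvPolynomial.X i : MvPolynomial (Fin n) K) + MvPolynomial.C (b i))
          (MvPolynomial.monomial (Finsupp.equivFunOnFinite.symm fun j => ((α j : ℕ))) (1 : K)) =
          ∏ j : Fin n, ((MvPolynomial.X j : MvPolynomial (Fin n) K) + MvPolynomial.C (b j)) ^ ((α j : ℕ)) := by
        rw [MvPolynomial.aeval_monomial, map_one, one_mul, Finsupp.prod_fintype _ _ fun i => pow_zero _]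
        simp only [Finsupp.coe_equivFunOnFinite_symm]
      rw [map_mul, hmon, aeval_shift_expand, ← sub_mul]
      refine Ideal.mul_mem_right _ _ ?_
      exact expand_sub_C_mem_span_X_pow p (MvPolynomial.aeval
        (fun i : Fin n => (MvPolynomial.X i : MvPolynomial (Fin n) K) + MvPolynomial.C (b i ^ p))
          (MvPolynomial.map (algebraMap k K) (c α)))
    have h4 := Ideal.sub_mem _ hτJ hdiff
    rwa [← Finset.sum_sub_distrib, Finset.sum_congr rfl fun α _ => sub_sub_cancel _ _] at h4
  -- all `yᵢ`-degrees of `P` are `< p`, so `P = 0`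
  have hP0 : ∑ α : Fin n → Fin p, MvPolynomial.C (s α) *
      ∏ j : Fin n, ((MvPolynomial.X j : MvPolynomial (Fin n) K) + MvPolynomial.C (b j)) ^ ((α j : ℕ)) = 0 := by
    refine eq_zero_of_mem_of_degreeOf_lt p hp hP fun i => ?_
    refine lt_of_le_of_lt (MvPolynomial.degreeOf_sum_le i _ _) ?_
    refine (Finset.sup_lt_iff hp).mpr fun α _ => ?_
    refine lt_of_le_of_lt (MvPolynomial.degreeOf_mul_le i _ _) ?_
    rw [MvPolynomial.degreeOf_C, zero_add]
    exact lt_of_le_of_lt (degreeOf_prod_shift_pow_le b (fun j => ((α j : ℕ))) i) (α i).is_lt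
  -- shift back: `Σ_α C(s_α) y^α = 0`, so every `s_α = 0`
  have hH0 : ∑ α : Fin n → Fin p, MvPolynomial.C (s α) *
      MvPolynomial.monomial (Finsupp.equivFunOnFinite.symm fun j => ((α j : ℕ))) (1 : K) = 0 := by
    have h5 := congrArg (MvPolynomial.aeval
      (fun i : Fin n => (MvPolynomial.X i : MvPolynomial (Fin n) K) - MvPolynomial.C (b i))) hP0
    rw [map_zero, map_sum] at h5
    rw [← h5]
    refine Finset.sum_congr rfl fun α _ => ?_
    rw [map_mul, MvPolynomial.aeval_C, MvPolynomial.algebraMap_eq, map_prod]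
    congr 1
    rw [MvPolynomial.monomial_eq, MvPolynomial.C_1, one_mul, Finsupp.prod_fintype _ _ fun i => pow_zero _]
    refine Finset.prod_congr rfl fun j _ => ?_
    rw [map_pow, map_add, MvPolynomial.aeval_X, MvPolynomial.aeval_C, MvPolynomial.algebraMap_eq, sub_add_cancel]
    simp only [Finsupp.coe_equivFunOnFinite_symm]
  have hs0 := eq_zero_of_sum_C_mul_monomial_eq_zero p s hH0 α₀
  -- but `s_{α₀} = c_{α₀}(b^p) = ψ_p(c_{α₀})(b) ≠ 0`
  apply hα₀
  rw [MvPolynomial.aeval_expand]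
  rw [hs_def] at hs0
  simp only at hs0
  rw [constantCoeff_aeval_shift, MvPolynomial.eval_map] at hs0
  rw [← hs0]
  rfl

/-! ## §2 (§2′) Fedder's test at every point of one stratum from its TRUNCATED cell -/

/-- **§2′ FEDDER'S TEST AT EVERY POINT OF ONE STRATUM FROM ITS TRUNCATED CELL.** As `KLocCell.fedderAt_of_kLocCell`
(distinct reduced exponents `e.1 < p`, cofactors `1 = Σ rr_e · expand p e.2 + Σ_{i∈S} t i · Y_i + t₀ · g`), but the split is
required only modulo `(Y_i^p : i ∈ S)`:
`g^(p-1) − Σ_{e ∈ L} Y^{e.1} · expand p e.2 ∈ Ideal.span ((fun i => Y_i^p) '' S)`. Then for every field `K ⊇ k` and every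
`K`-point `a` with `a_i = 0 (i ∈ S)` and `g(a) = 0`: `(g ⊗ K)^(p-1) ∉ ((Y_i − a_i)^p : i)`. Proof: the dropped part maps into
`((Y_i − a_i)^p : i)` because `Y_i^p = (Y_i − a_i)^p` for `i ∈ S`; the kept sum regroups by residue classes (singleton fibres) and
has a non-vanishing `p`-coefficient at `a` (§1 of `KLocCell`), so §1 keeps it out. [folklore; cite: Fedder1983, Prop. 1.7] -/
theorem fedderAt_of_kLocCell_mod : ∀ (p : ℕ) [Fact p.Prime] (k : Type) [Field k] [CharP k p] (n : ℕ)
    (S : Finset (Fin n)) (g : MvPolynomial (Fin n) k)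
    (L : List ((Fin n →₀ ℕ) × MvPolynomial (Fin n) k)) (rr : List (MvPolynomial (Fin n) k))
    (t : Fin n → MvPolynomial (Fin n) k) (t₀ : MvPolynomial (Fin n) k),
    (L.map Prod.fst).Nodup → (∀ e ∈ L, ∀ i : Fin n, e.1 i < p) →
    g ^ (p - 1) - (L.map fun e => MvPolynomial.monomial e.1 (1 : k) * MvPolynomial.expand p e.2).sum ∈
      Ideal.span ((fun i : Fin n => (MvPolynomial.X i : MvPolynomial (Fin n) k) ^ p) '' (S : Set (Fin n))) →
    (1 : MvPolynomial (Fin n) k) = (List.zipWith (fun r e => r * MvPolynomial.expand p e.2) rr L).sum +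
      ∑ i ∈ S, t i * MvPolynomial.X i + t₀ * g →
    ∀ (K : Type) [Field K] [Algebra k K] (a : Fin n → K), (∀ i ∈ S, a i = 0) → MvPolynomial.aeval a g = 0 →
      (MvPolynomial.map (algebraMap k K) g) ^ (p - 1) ∉
        Ideal.span (Set.range fun i : Fin n => (MvPolynomial.X i - MvPolynomial.C (a i)) ^ p) := by
  intro p _ k _ _ n S g L rr t t₀ hnd hbd hsplit hcof K _ _ a haS hga
  classical
  have hp : 0 < p := (Fact.out : p.Prime).pos
  -- residue classes of the (reduced) exponents (as in `KLocCell.fedderAt_of_kLocCell`)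
  let cls : (Fin n →₀ ℕ) → (Fin n → Fin p) := fun γ j => ⟨γ j % p, Nat.mod_lt _ hp⟩
  have hcls : ∀ e ∈ L, (Finsupp.equivFunOnFinite.symm fun j => ((cls e.1 j : ℕ)) : Fin n →₀ ℕ) = e.1 := by
    intro e he
    ext j
    simp only [Finsupp.coe_equivFunOnFinite_symm, cls]
    exact Nat.mod_eq_of_lt (hbd e he j)
  have hinj : ∀ e ∈ L, ∀ e' ∈ L, cls e.1 = cls e'.1 → e = e' := by
    intro e he e' he' h
    have h2 := congrArg (fun β : Fin n → Fin p => (Finsupp.equivFunOnFinite.symm fun j => ((β j : ℕ)) : Fin n →₀ ℕ)) h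
    rw [hcls e he, hcls e' he'] at h2
    exact List.inj_on_of_nodup_map hnd he he' h2
  have hL : L.Nodup := List.Nodup.of_map _ hnd
  -- the kept sum in function-indexed split form
  let c : (Fin n → Fin p) → MvPolynomial (Fin n) k := fun α => ∑ e ∈ L.toFinset with cls e.1 = α, e.2
  have hF : (L.map fun e => MvPolynomial.monomial e.1 (1 : k) * MvPolynomial.expand p e.2).sum =
      ∑ α : Fin n → Fin p, MvPolynomial.expand p (c α) *
        MvPolynomial.monomial (Finsupp.equivFunOnFinite.symm fun j => ((α j : ℕ))) 1 := by
    rw [← List.sum_toFinset _ hL]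
    symm
    calc ∑ α : Fin n → Fin p, MvPolynomial.expand p (c α) *
          MvPolynomial.monomial (Finsupp.equivFunOnFinite.symm fun j => ((α j : ℕ))) 1
        = ∑ α : Fin n → Fin p, ∑ e ∈ L.toFinset with cls e.1 = α,
            MvPolynomial.monomial e.1 (1 : k) * MvPolynomial.expand p e.2 := by
          refine Finset.sum_congr rfl fun α _ => ?_
          simp only [c, map_sum, Finset.sum_mul]
          refine Finset.sum_congr rfl fun e he => ?_
          rw [Finset.mem_filter] at he
          rw [mul_comm, ← he.2, hcls e (List.mem_toFinset.mp he.1)]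
      _ = ∑ e ∈ L.toFinset, MvPolynomial.monomial e.1 (1 : k) * MvPolynomial.expand p e.2 :=
          Finset.sum_fiberwise L.toFinset (fun e => cls e.1) _
  -- a non-vanishing `p`-coefficient at `a`
  obtain ⟨e₀, he₀, hne⟩ := KLocCell.exists_aeval_expand_ne_zero S g L rr t t₀ hcof a haS hga
  have hc : aeval a (MvPolynomial.expand p (c (cls e₀.1))) = aeval a (MvPolynomial.expand p e₀.2) := by
    simp only [c, map_sum]
    refine Finset.sum_eq_single_of_mem e₀ (Finset.mem_filter.mpr ⟨List.mem_toFinset.mpr he₀, rfl⟩) fun e he hne' => ?_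
    exact absurd (hinj e (List.mem_toFinset.mp (Finset.mem_filter.mp he).1) e₀ he₀ (Finset.mem_filter.mp he).2) hne'
  -- the dropped part lies in `((Y_i − a_i)^p : i)` upstairs
  intro hmem
  have hD : MvPolynomial.map (algebraMap k K)
      (g ^ (p - 1) - (L.map fun e => MvPolynomial.monomial e.1 (1 : k) * MvPolynomial.expand p e.2).sum) ∈
      Ideal.span (Set.range fun i : Fin n => (MvPolynomial.X i - MvPolynomial.C (a i)) ^ p) := by
    have h1 := Ideal.mem_map_of_mem (MvPolynomial.map (σ := Fin n) (algebraMap k K)) hsplit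
    rw [Ideal.map_span, ← Set.image_comp] at h1
    refine (Ideal.span_le.mpr ?_) h1
    rintro _ ⟨i, hi, rfl⟩
    have hai : a i = 0 := haS i hi
    refine Ideal.subset_span ⟨i, ?_⟩
    simp only [Function.comp_apply, map_pow, MvPolynomial.map_X, hai, map_zero, sub_zero]
  have hkept : MvPolynomial.map (algebraMap k K)
      (L.map fun e => MvPolynomial.monomial e.1 (1 : k) * MvPolynomial.expand p e.2).sum ∈
      Ideal.span (Set.range fun i : Fin n => (MvPolynomial.X i - MvPolynomial.C (a i)) ^ p) := by
    have hmem' : MvPolynomial.map (algebraMap k K) (g ^ (p - 1)) ∈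
        Ideal.span (Set.range fun i : Fin n => (MvPolynomial.X i - MvPolynomial.C (a i)) ^ p) := by
      rw [map_pow]; exact hmem
    have h2 := Ideal.sub_mem _ hmem' hD
    rwa [map_sub, sub_sub_cancel] at h2
  exact notMem_of_split_of_aeval_expand_ne_zero p _ c hF a ⟨cls e₀.1, by rw [hc]; exact hne⟩ hkept

/-! ## §3 (§3′) `hon'` of one hypersurface chart from the strata cover and the truncated cells -/

section Chart

variable (p : ℕ) [Fact p.Prime] (k : Type) [Field k] [CharP k p] (n : ℕ)

/-- **THE COVER AND THE TRUNCATED CELLS ⟹ FEDDER AT EVERY POINT UNDER THE CENTRE** (`KLocCell.pointFedder_of_kLocCells` with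
the cells binder weakened to the truncated split of §2). [folklore; cite: Fedder1983, Prop. 1.7] -/
theorem pointFedder_of_kLocCells_mod (J : Finset (Fin n)) (V : Matrix (Fin n) (Fin n) ℕ) (g : MvPolynomial (Fin n) k)
    (SS : List (Finset (Fin n)))
    (hcov : ∀ T : Finset (Fin n), (∀ j ∈ J, ∃ i ∈ T, 0 < V i j) → ∃ S ∈ SS, S ⊆ T)
    (hcells : ∀ S ∈ SS, ∃ (L : List ((Fin n →₀ ℕ) × MvPolynomial (Fin n) k)) (rr : List (MvPolynomial (Fin n) k))
        (t : Fin n → MvPolynomial (Fin n) k) (t₀ : MvPolynomial (Fin n) k),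
        (L.map Prod.fst).Nodup ∧ (∀ e ∈ L, ∀ i : Fin n, e.1 i < p) ∧
        g ^ (p - 1) - (L.map fun e => MvPolynomial.monomial e.1 (1 : k) * MvPolynomial.expand p e.2).sum ∈
          Ideal.span ((fun i : Fin n => (MvPolynomial.X i : MvPolynomial (Fin n) k) ^ p) '' (S : Set (Fin n))) ∧
        (1 : MvPolynomial (Fin n) k) = (List.zipWith (fun r e => r * MvPolynomial.expand p e.2) rr L).sum +
          ∑ i ∈ S, t i * MvPolynomial.X i + t₀ * g)
    (K : Type) [Field K] [Algebra k K] (b : Fin n → K) (hgb : MvPolynomial.aeval b g = 0)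
    (hθ : ∀ j ∈ J, MvPolynomial.aeval b (∏ i : Fin n, (X i : MvPolynomial (Fin n) k) ^ V i j) = 0) :
    (MvPolynomial.map (algebraMap k K) g) ^ (p - 1) ∉
        Ideal.span (Set.range fun i : Fin n => (MvPolynomial.X i - MvPolynomial.C (b i)) ^ p) := by
  classical
  -- the orthant of `b` meets every column of `V` indexed by `J`
  have hT : ∀ j ∈ J, ∃ i ∈ (Finset.univ.filter fun i : Fin n => b i = 0), 0 < V i j := by
    intro j hj
    have h := hθ j hj
    rw [map_prod, Finset.prod_eq_zero_iff] at h
    obtain ⟨i, -, hi⟩ := h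
    rw [map_pow, MvPolynomial.aeval_X, pow_eq_zero_iff'] at hi
    exact ⟨i, Finset.mem_filter.mpr ⟨Finset.mem_univ i, hi.1⟩, Nat.pos_of_ne_zero hi.2⟩
  obtain ⟨S, hS, hST⟩ := hcov _ hT
  obtain ⟨L, rr, t, t₀, hnd, hbd, hsplit, hcof⟩ := hcells S hS
  exact fedderAt_of_kLocCell_mod p k n S g L rr t t₀ hnd hbd hsplit hcof K b
    (fun i hi => (Finset.mem_filter.mp (hST hi)).2) hgb

/-- **§3′ (`Ideal.span {g}` form) `hon'` OF ONE HYPERSURFACE CHART FROM ITS TRUNCATED STRATUM CELLS**: as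
`KLocCell.honQuot_of_kLocCells`, with the weakened cells binder of §2. `pointFedder_of_kLocCells_mod` ∘
`KLocCell.quotientChartClause_of_pointFedder`. [folklore; cite: Fedder1983, Prop. 1.7 and Thm. 1.12] -/
theorem honQuot_of_kLocCells_mod (J : Finset (Fin n)) (V : Matrix (Fin n) (Fin n) ℕ) (g : MvPolynomial (Fin n) k)
    (hg0 : g ≠ 0) (hX : ∀ i : Fin n, ¬ (MvPolynomial.X i ∣ g)) (SS : List (Finset (Fin n)))
    (hcov : ∀ T : Finset (Fin n), (∀ j ∈ J, ∃ i ∈ T, 0 < V i j) → ∃ S ∈ SS, S ⊆ T)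
    (hcells : ∀ S ∈ SS, ∃ (L : List ((Fin n →₀ ℕ) × MvPolynomial (Fin n) k)) (rr : List (MvPolynomial (Fin n) k))
        (t : Fin n → MvPolynomial (Fin n) k) (t₀ : MvPolynomial (Fin n) k),
        (L.map Prod.fst).Nodup ∧ (∀ e ∈ L, ∀ i : Fin n, e.1 i < p) ∧
        g ^ (p - 1) - (L.map fun e => MvPolynomial.monomial e.1 (1 : k) * MvPolynomial.expand p e.2).sum ∈
          Ideal.span ((fun i : Fin n => (MvPolynomial.X i : MvPolynomial (Fin n) k) ^ p) '' (S : Set (Fin n))) ∧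
        (1 : MvPolynomial (Fin n) k) = (List.zipWith (fun r e => r * MvPolynomial.expand p e.2) rr L).sum +
          ∑ i ∈ S, t i * MvPolynomial.X i + t₀ * g) :
    ∀ (Q' : Ideal (MvPolynomial (Fin n) k ⧸ Ideal.span {g})) [Q'.IsMaximal],
      (∀ j ∈ J, Ideal.Quotient.mk (Ideal.span {g})
        (aeval (fun j : Fin n => ∏ i : Fin n, (X i : MvPolynomial (Fin n) k) ^ V i j) (X j : MvPolynomial (Fin n) k)) ∈ Q') →
        (∀ i : Fin n, (X i : MvPolynomial (Fin n) k) ∈ Q'.comap (Ideal.Quotient.mk (Ideal.span {g})) →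
          IsSMulRegular (Localization.AtPrime (Q'.comap (Ideal.Quotient.mk (Ideal.span {g}))) ⧸
              (Ideal.span {g}).map (algebraMap (MvPolynomial (Fin n) k)
                (Localization.AtPrime (Q'.comap (Ideal.Quotient.mk (Ideal.span {g}))))))
            (algebraMap (MvPolynomial (Fin n) k)
              (Localization.AtPrime (Q'.comap (Ideal.Quotient.mk (Ideal.span {g})))) (X i))) ∧
        ∀ dd : ℕ, ringKrullDim (Localization.AtPrime Q') = dd → ∀ s : Fin dd → Localization.AtPrime Q',
          (Ideal.span (Set.range s)).radical.IsMaximal →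
            RingTheory.Sequence.IsWeaklyRegular (Localization.AtPrime Q') (List.ofFn s) ∧
            ∀ y : Localization.AtPrime Q', (∃ e : ℕ, y ^ p ^ e ∈ Ideal.span
              ((fun z : Localization.AtPrime Q' => z ^ p ^ e) ''
                (Ideal.span (Set.range s) : Set (Localization.AtPrime Q')))) → y ∈ Ideal.span (Set.range s) :=
  KLocCell.quotientChartClause_of_pointFedder p k n J V g hg0 hX fun K _ _ b hgb hθ =>
    pointFedder_of_kLocCells_mod p k n J V g SS hcov hcells K b hgb hθ

/-- **§3′ (`Set.range` form) `hon' c` of `ciCertificates` at `r = 1` from the strata cover and the truncated cells** —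
the same for `gs : Fin 1 → k[Y]`, `g = gs 0`, over `Ideal.span (Set.range gs)`; plug as
`hon' c := KLocCellMod.honQuot_of_kLocCells_mod_range p k n J (V c) (gs c) …`. `pointFedder_of_kLocCells_mod` ∘
`KLocCellRange.quotientChartClause_of_pointFedder_range`. [folklore; cite: Fedder1983, Prop. 1.7 and Thm. 1.12] -/
theorem honQuot_of_kLocCells_mod_range (J : Finset (Fin n)) (V : Matrix (Fin n) (Fin n) ℕ)
    (gs : Fin 1 → MvPolynomial (Fin n) k)
    (hg0 : gs 0 ≠ 0) (hX : ∀ i : Fin n, ¬ (MvPolynomial.X i ∣ gs 0)) (SS : List (Finset (Fin n)))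
    (hcov : ∀ T : Finset (Fin n), (∀ j ∈ J, ∃ i ∈ T, 0 < V i j) → ∃ S ∈ SS, S ⊆ T)
    (hcells : ∀ S ∈ SS, ∃ (L : List ((Fin n →₀ ℕ) × MvPolynomial (Fin n) k)) (rr : List (MvPolynomial (Fin n) k))
        (t : Fin n → MvPolynomial (Fin n) k) (t₀ : MvPolynomial (Fin n) k),
        (L.map Prod.fst).Nodup ∧ (∀ e ∈ L, ∀ i : Fin n, e.1 i < p) ∧
        gs 0 ^ (p - 1) - (L.map fun e => MvPolynomial.monomial e.1 (1 : k) * MvPolynomial.expand p e.2).sum ∈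
          Ideal.span ((fun i : Fin n => (MvPolynomial.X i : MvPolynomial (Fin n) k) ^ p) '' (S : Set (Fin n))) ∧
        (1 : MvPolynomial (Fin n) k) = (List.zipWith (fun r e => r * MvPolynomial.expand p e.2) rr L).sum +
          ∑ i ∈ S, t i * MvPolynomial.X i + t₀ * gs 0) :
    ∀ (Q' : Ideal (MvPolynomial (Fin n) k ⧸ Ideal.span (Set.range gs))) [Q'.IsMaximal],
      (∀ j ∈ J, Ideal.Quotient.mk (Ideal.span (Set.range gs))
        (aeval (fun j : Fin n => ∏ i : Fin n, (X i : MvPolynomial (Fin n) k) ^ V i j) (X j : MvPolynomial (Fin n) k)) ∈ Q') →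
        (∀ i : Fin n, (X i : MvPolynomial (Fin n) k) ∈ Q'.comap (Ideal.Quotient.mk (Ideal.span (Set.range gs))) →
          IsSMulRegular (Localization.AtPrime (Q'.comap (Ideal.Quotient.mk (Ideal.span (Set.range gs)))) ⧸
              (Ideal.span (Set.range gs)).map (algebraMap (MvPolynomial (Fin n) k)
                (Localization.AtPrime (Q'.comap (Ideal.Quotient.mk (Ideal.span (Set.range gs)))))))
            (algebraMap (MvPolynomial (Fin n) k)
              (Localization.AtPrime (Q'.comap (Ideal.Quotient.mk (Ideal.span (Set.range gs))))) (X i))) ∧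
        ∀ dd : ℕ, ringKrullDim (Localization.AtPrime Q') = dd → ∀ s : Fin dd → Localization.AtPrime Q',
          (Ideal.span (Set.range s)).radical.IsMaximal →
            RingTheory.Sequence.IsWeaklyRegular (Localization.AtPrime Q') (List.ofFn s) ∧
            ∀ y : Localization.AtPrime Q', (∃ e : ℕ, y ^ p ^ e ∈ Ideal.span
              ((fun z : Localization.AtPrime Q' => z ^ p ^ e) ''
                (Ideal.span (Set.range s) : Set (Localization.AtPrime Q')))) → y ∈ Ideal.span (Set.range s) :=
  KLocCellRange.quotientChartClause_of_pointFedder_range p k n J V gs hg0 hX fun K _ _ b hgb hθ =>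
    pointFedder_of_kLocCells_mod p k n J V (gs 0) SS hcov hcells K b hgb hθ

omit [Fact p.Prime] [CharP k p] in
/-- **The exact cell is a truncated cell** (the exact split gives difference `0`): the binder of
`KLocCell.honQuot_of_kLocCells` implies the weakened binder, so consumers may feed either. [folklore] -/
theorem cellsMod_of_cells (g : MvPolynomial (Fin n) k) (SS : List (Finset (Fin n)))
    (hcells : ∀ S ∈ SS, ∃ (L : List ((Fin n →₀ ℕ) × MvPolynomial (Fin n) k)) (rr : List (MvPolynomial (Fin n) k))
        (t : Fin n → MvPolynomial (Fin n) k) (t₀ : MvPolynomial (Fin n) k),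
        (L.map Prod.fst).Nodup ∧ (∀ e ∈ L, ∀ i : Fin n, e.1 i < p) ∧
        g ^ (p - 1) = (L.map fun e => MvPolynomial.monomial e.1 (1 : k) * MvPolynomial.expand p e.2).sum ∧
        (1 : MvPolynomial (Fin n) k) = (List.zipWith (fun r e => r * MvPolynomial.expand p e.2) rr L).sum +
          ∑ i ∈ S, t i * MvPolynomial.X i + t₀ * g) :
    ∀ S ∈ SS, ∃ (L : List ((Fin n →₀ ℕ) × MvPolynomial (Fin n) k)) (rr : List (MvPolynomial (Fin n) k))
        (t : Fin n → MvPolynomial (Fin n) k) (t₀ : MvPolynomial (Fin n) k),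
        (L.map Prod.fst).Nodup ∧ (∀ e ∈ L, ∀ i : Fin n, e.1 i < p) ∧
        g ^ (p - 1) - (L.map fun e => MvPolynomial.monomial e.1 (1 : k) * MvPolynomial.expand p e.2).sum ∈
          Ideal.span ((fun i : Fin n => (MvPolynomial.X i : MvPolynomial (Fin n) k) ^ p) '' (S : Set (Fin n))) ∧
        (1 : MvPolynomial (Fin n) k) = (List.zipWith (fun r e => r * MvPolynomial.expand p e.2) rr L).sum +
          ∑ i ∈ S, t i * MvPolynomial.X i + t₀ * g := by
  intro S hS
  obtain ⟨L, rr, t, t₀, hnd, hbd, hsplit, hcof⟩ := hcells S hS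
  exact ⟨L, rr, t, t₀, hnd, hbd, by rw [hsplit, sub_self]; exact Ideal.zero_mem _, hcof⟩

end Chart

end Summit.ResolutionOfSingularities.ResolutionOfSingularities.Theorems.FInjectiveMacaulayfication.KLocCellMod

end
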